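import Mathlib.LinearAlgebra.Matrix.Adjugate
import Mathlib.LinearAlgebra.Matrix.Notation
import Mathlib.LinearAlgebra.Matrix.Trace
import Mathlib.Data.Matrix.Mul
import Mathlib.Algebra.BigOperators.Group.Finset.Basic
import Mathlib.Tactic.Ring
import Mathlib.Tactic.FinCases
import HarnessLib

/-!
# Route `ByReductionTypeAtTwo`, crux `RankOneAtTwoOffBigImageOddLocal` (stmt-BirchSwinnertonDyer-23716), line
# `refined_kolyvagin_tamagawa_shift_at_two`, stub `stub_sigmaShiftPosDisc`: THE PAIRING OF HECKE CONSTITUENTS AT A τ′-REAL POINT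
# (pure 2×2 matrix algebra + an abstract period functional, PROVED)

Lead prover `prover-cruxlead-stmt-BirchSwinnertonDyer-23716-g12` (2026-08-29), `--supports stmt-BirchSwinnertonDyer-23716` (helper; closes
nothing).  THEOREMS ONLY (no definition, no named fact, no `sorry`).  Companion memo `Cruxes/RankOneAtTwoOffBigImageOddLocal/ArchBoundaryBitAtTwo.md`
v4 §7(d), §8.3 (crux commit c4da069c0734) and `MS-probe-RESULTS.md`.

WHY.  The boundary-level archimedean Selmer bit of Kolyvagin's class at `p = 2` on `{Δ > 0}` is the real component of a `τ′`-real Heegner value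
(memos g4–g11, kernels p687908/p688427/p697046), and the component of `Φ(x)` for a `τ′ = w_N∘conj`-real point `x = [z]` of `X₀(N)` is the minus
period of `g = M J` mod `2`, where `z ↦ M z̄` is the reflection fixing `z` (`tr M = 0`, `det M = −N`) and `J = diag(−1,1)` (memo §8.1).  The Hecke
operator `T_ℓ` decomposes `δ_i g = γ_i δ_{π(i)}` over `i ∈ ℙ¹(𝔽_ℓ)` and `Σ_i Per(γ_i) = a_ℓ Per(g)`.  This file proves the PAIRING behind the «pair
equality» (kit T2 950/950) and behind the reduction of conjecture A∞′ to single constituents (memo §8.3):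

* §1 `J`-conjugation `X ↦ J X J` (complex conjugation `c` on `Γ₀(N)`): multiplicative, commutes with the adjugate, preserves `det`; a
  trace-zero `M` has `M² = −det M` (Cayley–Hamilton), so `g = M J` satisfies `g · g^c = g^c · g = (−det M) • 1 = N • 1`.
* §2 THE PARTNER: from `δ g = γ δ′` and `g^c g = N • 1`:  `det γ • (δ′^c g) = N • ((adj γ)^c δ^c)` — so when `det γ = N` is cancellable,
  `δ′^c g = (adj γ)^c δ^c`: the constituent through `(δ′^c, δ^c)` is `γ′ = (adj γ)^c`; the assignment is an involution (`adj adj = id`, `cc = id`),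
  and at a FIXED pair (`δ′ = δ^c`) the constituent satisfies `γ δ^c = (adj γ)^c δ^c`, i.e. is itself of reflection type.
* §3 THE PERIOD SIDE: for any map `φ` into an additive group with `φ(X^c) = σ(φ X)` (`σ` additive: complex conjugation of the period lattice) and
  `φ(adj X) = −φ X` on `det = N` elements (inverse up to the scalar `N`): `φ γ′ = −σ(φ γ)`; hence a functional `μ` with `μ ∘ σ = −μ` (MINUS part)
  takes EQUAL values on partners and one with `π ∘ σ = π` (PLUS part) takes OPPOSITE values — the exact facts `y(k/ℓ) = y(k′/ℓ)`,
  `x(k/ℓ) = −x(k′/ℓ)` for `k k′ N ≡ 1 (mod ℓ)` of the probe (all `ℓ < 90`, 37a1/79a1).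
* §4 MOD 2: over a finite index set with an involution whose non-fixed points pair equal values, the total equals the sum over the FIXED points
  modulo `2` — `Σ_{real j} λ(x_j) ≡ a_ℓ λ(x)`, and for the principal oval `Σ_{k<ℓ/2} y(k/ℓ) ≡ y(s/ℓ)·[(N/ℓ) = +1]` (memo §8.3).

BSD is NOT proved by any of this; the crux is NOT proved; the stub is NOT proved; A∞′ / MS-even are NOT proved.

References: [Merel1994] L. Merel, *Universal Fourier expansions of modular forms*, in: On Artin's conjecture for odd 2-dimensional
representations, LNM 1585 (1994) §1.2–1.3 (Heilbronn–Manin matrices, `T_ℓ` on Manin symbols); [Cremona1997] J. E. Cremona, *Algorithms for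
modular elliptic curves*, 2nd ed. (1997), §2.1–2.2, §2.8 (periods, real structure, `{0, b/d}`); [GrossLMS1991] B. H. Gross, LMS LNS 153 (1991) §5.
-/

set_option linter.dupNamespace false -- tree convention: `Summit.BirchSwinnertonDyer.BirchSwinnertonDyer.Theorems` (summit = sub-problem)
set_option autoImplicit false

open Matrix

namespace Summit.BirchSwinnertonDyer.BirchSwinnertonDyer.Theorems.OffBigImageOddLocalAtTwo.ArchHeckePairing

/-! ## §1 Conjugation by `J = diag(−1, 1)` and the reflection identity -/

section Conj

variable {R : Type*} [CommRing R]

/-- `J² = 1` for `J = diag(−1,1)` (the matrix of `z ↦ −z`, so that `c(z) = −z̄ = J z̄`). [folklore] -/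
theorem J_mul_J : (!![-1, 0; 0, 1] : Matrix (Fin 2) (Fin 2) R) * !![-1, 0; 0, 1] = 1 := by
  rw [Matrix.mul_fin_two, Matrix.one_fin_two]
  ext i j; fin_cases i <;> fin_cases j <;> simp

/-- Entries of the conjugate: `J X J = [[x₀₀, −x₀₁],[−x₁₀, x₁₁]]` (off-diagonal signs flip — `γ ↦ γ^c`, the action of complex conjugation on
`Γ₀(N)`). [cite: Cremona1997, §2.1] -/
theorem conj_eq (X : Matrix (Fin 2) (Fin 2) R) :
    (!![-1, 0; 0, 1] : Matrix (Fin 2) (Fin 2) R) * X * !![-1, 0; 0, 1] = !![X 0 0, -X 0 1; -X 1 0, X 1 1] := by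
  nth_rewrite 1 [Matrix.eta_fin_two X]
  rw [Matrix.mul_fin_two, Matrix.mul_fin_two]
  ext i j; fin_cases i <;> fin_cases j <;> simp

/-- Conjugation is multiplicative: `(X Y)^c = X^c Y^c`. [folklore] -/
theorem conj_mul (X Y : Matrix (Fin 2) (Fin 2) R) :
    (!![-1, 0; 0, 1] : Matrix (Fin 2) (Fin 2) R) * (X * Y) * !![-1, 0; 0, 1] =
      ((!![-1, 0; 0, 1] : Matrix (Fin 2) (Fin 2) R) * X * !![-1, 0; 0, 1]) * (!![-1, 0; 0, 1] * Y * !![-1, 0; 0, 1]) := by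
  rw [show ((!![-1, 0; 0, 1] : Matrix (Fin 2) (Fin 2) R) * X * !![-1, 0; 0, 1]) * (!![-1, 0; 0, 1] * Y * !![-1, 0; 0, 1]) =
      (!![-1, 0; 0, 1] : Matrix (Fin 2) (Fin 2) R) * X * (!![-1, 0; 0, 1] * !![-1, 0; 0, 1]) * Y * !![-1, 0; 0, 1] by
        simp only [Matrix.mul_assoc], J_mul_J, Matrix.mul_one]
  simp only [Matrix.mul_assoc]

/-- Conjugation is an involution: `(X^c)^c = X`. [folklore] -/
theorem conj_conj (X : Matrix (Fin 2) (Fin 2) R) :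
    (!![-1, 0; 0, 1] : Matrix (Fin 2) (Fin 2) R) * ((!![-1, 0; 0, 1] : Matrix (Fin 2) (Fin 2) R) * X * !![-1, 0; 0, 1]) *
      !![-1, 0; 0, 1] = X := by
  rw [show (!![-1, 0; 0, 1] : Matrix (Fin 2) (Fin 2) R) * ((!![-1, 0; 0, 1] : Matrix (Fin 2) (Fin 2) R) * X * !![-1, 0; 0, 1]) *
      !![-1, 0; 0, 1] = ((!![-1, 0; 0, 1] : Matrix (Fin 2) (Fin 2) R) * !![-1, 0; 0, 1]) * X * (!![-1, 0; 0, 1] * !![-1, 0; 0, 1]) by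
        simp only [Matrix.mul_assoc], J_mul_J, Matrix.one_mul, Matrix.mul_one]

/-- Conjugation preserves the determinant. [folklore] -/
theorem det_conj (X : Matrix (Fin 2) (Fin 2) R) :
    ((!![-1, 0; 0, 1] : Matrix (Fin 2) (Fin 2) R) * X * !![-1, 0; 0, 1]).det = X.det := by
  rw [conj_eq, Matrix.det_fin_two, Matrix.det_fin_two]
  simp

/-- Conjugation commutes with the adjugate: `adj(X^c) = (adj X)^c`. [folklore] -/
theorem adjugate_conj (X : Matrix (Fin 2) (Fin 2) R) :
    ((!![-1, 0; 0, 1] : Matrix (Fin 2) (Fin 2) R) * X * !![-1, 0; 0, 1]).adjugate =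
      (!![-1, 0; 0, 1] : Matrix (Fin 2) (Fin 2) R) * X.adjugate * !![-1, 0; 0, 1] := by
  rw [conj_eq, conj_eq, Matrix.adjugate_fin_two, Matrix.adjugate_fin_two]
  ext i j; fin_cases i <;> fin_cases j <;> simp

/-- **Cayley–Hamilton for a trace-zero `2 × 2` matrix**: `M² = −det M • 1`.  For the reflection `z ↦ M z̄` through a `τ′`-real point
(`M = u S`, `tr M = 0`, `det M = −N`) this is `M² = N`. [cite: Cremona1997, §2.8] -/
theorem mul_self_of_trace_zero (M : Matrix (Fin 2) (Fin 2) R) (hM : M.trace = 0) : M * M = -(M.det • (1 : Matrix (Fin 2) (Fin 2) R)) := by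
  rw [Matrix.trace_fin_two] at hM
  have h11 : M 1 1 = -M 0 0 := eq_neg_of_add_eq_zero_right hM
  ext i j
  fin_cases i <;> fin_cases j <;> simp [Matrix.mul_apply, Fin.sum_univ_two, Matrix.det_fin_two, h11] <;> ring

/-- **`g g^c = N`** for `g = M J` with `tr M = 0`, `det M = −N`: the holomorphic lift `g` of the antiholomorphic reflection (`g(c z) = z`)
composed with its conjugate is the scalar `N`. [cite: Cremona1997, §2.8] -/
theorem mul_conj_eq_smul_of_reflection (M : Matrix (Fin 2) (Fin 2) R) (hM : M.trace = 0) {N : R} (hdet : M.det = -N) :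
    (M * !![-1, 0; 0, 1]) * ((!![-1, 0; 0, 1] : Matrix (Fin 2) (Fin 2) R) * (M * !![-1, 0; 0, 1]) * !![-1, 0; 0, 1]) =
      N • (1 : Matrix (Fin 2) (Fin 2) R) := by
  calc (M * !![-1, 0; 0, 1]) * ((!![-1, 0; 0, 1] : Matrix (Fin 2) (Fin 2) R) * (M * !![-1, 0; 0, 1]) * !![-1, 0; 0, 1])
      = M * ((!![-1, 0; 0, 1] : Matrix (Fin 2) (Fin 2) R) * !![-1, 0; 0, 1]) *
          (M * ((!![-1, 0; 0, 1] : Matrix (Fin 2) (Fin 2) R) * !![-1, 0; 0, 1])) := by simp only [Matrix.mul_assoc]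
    _ = M * M := by rw [J_mul_J, Matrix.mul_one]
    _ = N • 1 := by rw [mul_self_of_trace_zero M hM, hdet, neg_smul, neg_neg]

/-- … and in the other order: `g^c g = N`. [cite: Cremona1997, §2.8] -/
theorem conj_mul_eq_smul_of_reflection (M : Matrix (Fin 2) (Fin 2) R) (hM : M.trace = 0) {N : R} (hdet : M.det = -N) :
    ((!![-1, 0; 0, 1] : Matrix (Fin 2) (Fin 2) R) * (M * !![-1, 0; 0, 1]) * !![-1, 0; 0, 1]) * (M * !![-1, 0; 0, 1]) =
      N • (1 : Matrix (Fin 2) (Fin 2) R) := by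
  calc ((!![-1, 0; 0, 1] : Matrix (Fin 2) (Fin 2) R) * (M * !![-1, 0; 0, 1]) * !![-1, 0; 0, 1]) * (M * !![-1, 0; 0, 1])
      = (!![-1, 0; 0, 1] : Matrix (Fin 2) (Fin 2) R) * (M * ((!![-1, 0; 0, 1] : Matrix (Fin 2) (Fin 2) R) * !![-1, 0; 0, 1]) * M) *
          !![-1, 0; 0, 1] := by simp only [Matrix.mul_assoc]
    _ = (!![-1, 0; 0, 1] : Matrix (Fin 2) (Fin 2) R) * (N • (1 : Matrix (Fin 2) (Fin 2) R)) * !![-1, 0; 0, 1] := by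
          rw [J_mul_J, Matrix.mul_one, mul_self_of_trace_zero M hM, hdet, neg_smul, neg_neg]
    _ = N • 1 := by rw [Matrix.mul_smul, Matrix.mul_one, Matrix.smul_mul, J_mul_J]

end Conj

/-! ## §2 The partner of a Hecke constituent -/

section Partner

variable {R : Type*} [CommRing R]

/-- **THE PARTNER (general form).**  Let `g` satisfy `g^c g = N • 1` (§1: the lift of a reflection), and let `δ g = γ δ′` be one constituent of
the Hecke decomposition (`δ, δ′` of determinant `ℓ`, `γ ∈ Γ₀(N) W_N`).  Then `det γ • (δ′^c g) = N • ((adj γ)^c δ^c)`: up to the scalar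
`det γ = N`, the constituent through the conjugate pair `(δ′^c, δ^c)` is `γ′ = (adj γ)^c` — the Hecke constituents at a `τ′`-real point come in
PAIRS `i ↔ −π(i)` (memo §7(d)/§8.3). [cite: Merel1994, §1.3] [cite: Cremona1997, §2.8] -/
theorem partner_smul (g δ δ' γ : Matrix (Fin 2) (Fin 2) R) {N : R}
    (hg : ((!![-1, 0; 0, 1] : Matrix (Fin 2) (Fin 2) R) * g * !![-1, 0; 0, 1]) * g = N • (1 : Matrix (Fin 2) (Fin 2) R))
    (h : δ * g = γ * δ') :
    γ.det • (((!![-1, 0; 0, 1] : Matrix (Fin 2) (Fin 2) R) * δ' * !![-1, 0; 0, 1]) * g) =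
      N • (((!![-1, 0; 0, 1] : Matrix (Fin 2) (Fin 2) R) * γ.adjugate * !![-1, 0; 0, 1]) *
        ((!![-1, 0; 0, 1] : Matrix (Fin 2) (Fin 2) R) * δ * !![-1, 0; 0, 1])) := by
  -- conjugate the relation: δ^c g^c = γ^c δ'^c
  have hc : ((!![-1, 0; 0, 1] : Matrix (Fin 2) (Fin 2) R) * δ * !![-1, 0; 0, 1]) *
      ((!![-1, 0; 0, 1] : Matrix (Fin 2) (Fin 2) R) * g * !![-1, 0; 0, 1]) =
      ((!![-1, 0; 0, 1] : Matrix (Fin 2) (Fin 2) R) * γ * !![-1, 0; 0, 1]) *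
      ((!![-1, 0; 0, 1] : Matrix (Fin 2) (Fin 2) R) * δ' * !![-1, 0; 0, 1]) := by
    rw [← conj_mul, ← conj_mul, h]
  have hadj := adjugate_conj γ
  have hdet := det_conj γ
  set J : Matrix (Fin 2) (Fin 2) R := !![-1, 0; 0, 1] with hJ
  set γc : Matrix (Fin 2) (Fin 2) R := J * γ * J with hγc
  set dc : Matrix (Fin 2) (Fin 2) R := J * δ * J with hdc
  set d'c : Matrix (Fin 2) (Fin 2) R := J * δ' * J with hd'c
  set gc : Matrix (Fin 2) (Fin 2) R := J * g * J with hgc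
  -- multiply `hc` on the left by `adj(γ^c) = (adj γ)^c` and on the right by `g`, and use `adj(γ^c) γ^c = det γ`, `g^c g = N`
  calc γ.det • (d'c * g) = (Matrix.adjugate γc * γc) * (d'c * g) := by
        rw [Matrix.adjugate_mul, hdet, Matrix.smul_mul, Matrix.one_mul]
    _ = Matrix.adjugate γc * ((γc * d'c) * g) := by simp only [Matrix.mul_assoc]
    _ = Matrix.adjugate γc * ((dc * gc) * g) := by rw [← hc]
    _ = Matrix.adjugate γc * dc * (gc * g) := by simp only [Matrix.mul_assoc]
    _ = N • (J * γ.adjugate * J * dc) := by rw [hg, Matrix.mul_smul, Matrix.mul_one, hadj]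

/-- **THE PARTNER (cancelled form).**  Over an integral domain, if moreover `det γ = N ≠ 0` (`γ ∈ Γ₀(N) W_N`), then
`δ′^c g = (adj γ)^c δ^c` on the nose. [cite: Merel1994, §1.3] [cite: Cremona1997, §2.8] -/
theorem partner {R : Type*} [CommRing R] [IsDomain R] (g δ δ' γ : Matrix (Fin 2) (Fin 2) R) {N : R} (hN : N ≠ 0)
    (hg : ((!![-1, 0; 0, 1] : Matrix (Fin 2) (Fin 2) R) * g * !![-1, 0; 0, 1]) * g = N • (1 : Matrix (Fin 2) (Fin 2) R))
    (h : δ * g = γ * δ') (hγ : γ.det = N) :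
    ((!![-1, 0; 0, 1] : Matrix (Fin 2) (Fin 2) R) * δ' * !![-1, 0; 0, 1]) * g =
      ((!![-1, 0; 0, 1] : Matrix (Fin 2) (Fin 2) R) * γ.adjugate * !![-1, 0; 0, 1]) *
        ((!![-1, 0; 0, 1] : Matrix (Fin 2) (Fin 2) R) * δ * !![-1, 0; 0, 1]) := by
  have key := partner_smul g δ δ' γ hg h
  rw [hγ] at key
  ext i j
  have h' := congrArg (fun X : Matrix (Fin 2) (Fin 2) R ↦ X i j) key
  simp only [Matrix.smul_apply, smul_eq_mul] at h'
  exact mul_left_cancel₀ hN h'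

/-- The partner assignment is an INVOLUTION on constituents: `((adj ((adj γ)^c))^c) = γ` (`adj adj = id` for `2 × 2`, `cc = id`). [folklore] -/
theorem partner_partner (γ : Matrix (Fin 2) (Fin 2) R) :
    (!![-1, 0; 0, 1] : Matrix (Fin 2) (Fin 2) R) *
        ((!![-1, 0; 0, 1] : Matrix (Fin 2) (Fin 2) R) * γ.adjugate * !![-1, 0; 0, 1]).adjugate * !![-1, 0; 0, 1] = γ := by
  rw [adjugate_conj, Matrix.adjugate_adjugate _ (by simp), Fintype.card_fin, show 2 - 2 = 0 from rfl, pow_zero, one_smul,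
    conj_conj]

/-- **FIXED PAIRS ARE REFLECTION-TYPE.**  If the pair is self-conjugate (`δ′ = δ^c`: a REAL index `j = −π(j)`, memo §7(d)) then the constituent
satisfies `γ δ^c = (adj γ)^c δ^c`; with `δ^c` cancellable this is `γ^c = adj γ`, i.e. `γ γ^c = det γ = N` — `γ` is again the lift of a reflection
(`γ = u_j W_N`, `u_j` τ′-symmetric: the real points of `T_ℓ x` lie on ovals, memo §8.2). [cite: Cremona1997, §2.8] -/
theorem fixed_pair {R : Type*} [CommRing R] [IsDomain R] (g δ γ : Matrix (Fin 2) (Fin 2) R) {N : R} (hN : N ≠ 0)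
    (hg : ((!![-1, 0; 0, 1] : Matrix (Fin 2) (Fin 2) R) * g * !![-1, 0; 0, 1]) * g = N • (1 : Matrix (Fin 2) (Fin 2) R))
    (h : δ * g = γ * ((!![-1, 0; 0, 1] : Matrix (Fin 2) (Fin 2) R) * δ * !![-1, 0; 0, 1])) (hγ : γ.det = N) :
    γ * ((!![-1, 0; 0, 1] : Matrix (Fin 2) (Fin 2) R) * δ * !![-1, 0; 0, 1]) =
      ((!![-1, 0; 0, 1] : Matrix (Fin 2) (Fin 2) R) * γ.adjugate * !![-1, 0; 0, 1]) *
        ((!![-1, 0; 0, 1] : Matrix (Fin 2) (Fin 2) R) * δ * !![-1, 0; 0, 1]) := by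
  have key := partner g δ _ γ hN hg h hγ
  rw [conj_conj] at key
  rw [← h]
  exact key

end Partner

/-! ## §3 The period side: equal minus parts, opposite plus parts -/

section Period

variable {R : Type*} [CommRing R] {A : Type*} [AddCommGroup A]

/-- **`φ(γ′) = −σ(φ γ)`.**  For any `φ` from matrices to an additive group with `φ(X^c) = σ(φ X)` (`σ` additive — complex conjugation of the
period lattice, `Per(γ^c) = conj Per(γ)`) and `φ(adj γ) = −φ γ` (`adj γ = N γ⁻¹`, `Per(N γ⁻¹) = −Per γ`), the partner constituent `γ′ = (adj γ)^c`
has period `−σ(φ γ)`. [cite: Cremona1997, §2.8] -/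
theorem period_partner (φ : Matrix (Fin 2) (Fin 2) R → A) (σ : A →+ A)
    (hconj : ∀ X : Matrix (Fin 2) (Fin 2) R, φ ((!![-1, 0; 0, 1] : Matrix (Fin 2) (Fin 2) R) * X * !![-1, 0; 0, 1]) = σ (φ X))
    (γ : Matrix (Fin 2) (Fin 2) R) (hadj : φ γ.adjugate = -φ γ) :
    φ ((!![-1, 0; 0, 1] : Matrix (Fin 2) (Fin 2) R) * γ.adjugate * !![-1, 0; 0, 1]) = -σ (φ γ) := by
  rw [hconj, hadj, map_neg]

/-- **Equal MINUS parts**: a functional `μ` with `μ ∘ σ = −μ` (the imaginary coordinate `y`) takes the SAME value on partners —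
`y(k/ℓ) = y(k′/ℓ)` for `k k′ N ≡ 1 (mod ℓ)` (probe: exact for every `ℓ < 90`, 37a1 and 79a1). [cite: Cremona1997, §2.8] -/
theorem minus_partner_eq (φ : Matrix (Fin 2) (Fin 2) R → A) (σ : A →+ A) {B : Type*} [AddCommGroup B] (μ : A →+ B)
    (hμ : ∀ a : A, μ (σ a) = -μ a)
    (hconj : ∀ X : Matrix (Fin 2) (Fin 2) R, φ ((!![-1, 0; 0, 1] : Matrix (Fin 2) (Fin 2) R) * X * !![-1, 0; 0, 1]) = σ (φ X))
    (γ : Matrix (Fin 2) (Fin 2) R) (hadj : φ γ.adjugate = -φ γ) :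
    μ (φ ((!![-1, 0; 0, 1] : Matrix (Fin 2) (Fin 2) R) * γ.adjugate * !![-1, 0; 0, 1])) = μ (φ γ) := by
  rw [period_partner φ σ hconj γ hadj, map_neg, hμ, neg_neg]

/-- **Opposite PLUS parts**: a functional `π` with `π ∘ σ = π` (the real coordinate `x`) takes OPPOSITE values on partners —
`x(k/ℓ) = −x(k′/ℓ)`. [cite: Cremona1997, §2.8] -/
theorem plus_partner_eq_neg (φ : Matrix (Fin 2) (Fin 2) R → A) (σ : A →+ A) {B : Type*} [AddCommGroup B] (π : A →+ B)
    (hπ : ∀ a : A, π (σ a) = π a)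
    (hconj : ∀ X : Matrix (Fin 2) (Fin 2) R, φ ((!![-1, 0; 0, 1] : Matrix (Fin 2) (Fin 2) R) * X * !![-1, 0; 0, 1]) = σ (φ X))
    (γ : Matrix (Fin 2) (Fin 2) R) (hadj : φ γ.adjugate = -φ γ) :
    π (φ ((!![-1, 0; 0, 1] : Matrix (Fin 2) (Fin 2) R) * γ.adjugate * !![-1, 0; 0, 1])) = -π (φ γ) := by
  rw [period_partner φ σ hconj γ hadj, map_neg, hπ]

end Period

/-! ## §4 Mod 2: the sum over all constituents is the sum over the fixed ones -/

section ModTwo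

variable {ι : Type*} {B : Type*} [AddCommGroup B]

/-- **Pairs contribute evenly.**  On a finite index set with a map `p` (the partner `i ↦ −π(i)`) that is an involution off the fixed set
`F = {i | p i = i}` and a weight `w` with EQUAL values on partners (§3) and `2 • w = 0` in the target (an `𝔽₂`-module: `Λ/2Λ`, `E(ℝ)/E(ℝ)⁰`), the
total equals the sum over `F`: `Σ_{i} λ(x_i) = Σ_{real j} λ(x_j)`, which with `Σ_i = a_ℓ λ(x)` is the trace identity / the pair equality, and for the
principal oval gives `Σ_{k<ℓ/2} y(k/ℓ) ≡ y(s/ℓ)·[(N/ℓ) = +1]` (memo §8.3). [folklore] -/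
theorem sum_eq_sum_fixed [DecidableEq ι] (s : Finset ι) (p : ι → ι) (hp : ∀ i ∈ s, p i ∈ s)
    (hinv : ∀ i ∈ s, p (p i) = i) (w : ι → B) (hw : ∀ i ∈ s, w (p i) = w i) (h2 : ∀ i ∈ s, 2 • w i = 0) :
    ∑ i ∈ s, w i = ∑ i ∈ s.filter (fun i ↦ p i = i), w i := by
  rw [← Finset.sum_filter_add_sum_filter_not s (fun i ↦ p i = i)]
  suffices hz : ∑ i ∈ s.filter (fun i ↦ ¬ p i = i), w i = 0 by rw [hz, add_zero]
  refine Finset.sum_involution (fun i _ ↦ p i) ?_ ?_ ?_ ?_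
  · intro i hi
    rw [Finset.mem_filter] at hi
    rw [hw i hi.1, ← two_smul ℕ (w i), h2 i hi.1]
  · intro i hi _
    rw [Finset.mem_filter] at hi
    exact hi.2
  · intro i hi
    rw [Finset.mem_filter] at hi ⊢
    refine ⟨hp i hi.1, ?_⟩
    rw [hinv i hi.1]
    exact fun h ↦ hi.2 h.symm
  · intro i hi
    rw [Finset.mem_filter] at hi
    exact hinv i hi.1

end ModTwo

end Summit.BirchSwinnertonDyer.BirchSwinnertonDyer.Theorems.OffBigImageOddLocalAtTwo.ArchHeckePairing
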